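import Literature.MathematicalPhysics.QuantumManyBody.YukawaCutoffError
import HarnessLib

/-!
# The short-distance cutoff of Lieb–Solovej: the Yukawa kernel has mass `∫ Y_{1/r} = 4πr²`

Topic `Literature/MathematicalPhysics/QuantumManyBody` (electrostatics groundwork for the charged
Bose gas, `JelliumBoseGas.foldyLaw`; continuation of `YukawaCutoffError.lean`).
[LiebSolovej2001, §4 (4.4) and Lemma 4.1]: after the long-distance cutoff `R` the kernel
`V_R = Y_{R⁻¹}` is replaced by `V_{r,R} = Y_{R⁻¹} - Y_{r⁻¹}` (`Y_m(x) = e^{-m|x|}/|x|`,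
`0 < r ≤ R`). "This will lower the repulsive terms and for the attractive term we get
`-ρ ∑ⱼ ∫ w_R(xⱼ, y) dy ≥ -ρ ∑ⱼ ∫ w_{r,R}(xⱼ, y) dy - nρ sup_x ∫ χ_ℓ(x) e^{-|x-y|/r}|x-y|⁻¹ χ_ℓ(y) dy
≥ -ρ ∑ⱼ ∫ w_{r,R}(xⱼ, y) dy - const · nρr²`" [LiebSolovej2001, (4.4)], because
`∫_{ℝ³} e^{-|y|/r} |y|⁻¹ dy = 4πr²`. In the tree's subordinated normalisation
`K_μ(z) = ∫₀^∞ e^{-μs} G_s(z) ds = e^{-√μ|z|}/(4π|z|)` (`YukawaSubordination.lean`):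

* `Coulomb.lintegral_space_lintegral_exp_neg_mul_heatKernel` — Tonelli:
  `∫_{ℝ³} ∫₀^∞ e^{-μs} G_s(y) ds dy = ∫₀^∞ e^{-μs} ds = 1/μ` (`ℝ≥0∞`).
* `Coulomb.integral_yukawaKernel` — **`∫_{ℝ³} K_μ = 1/μ`** with integrability and measurability of
  `K_μ` (i.e. `∫ Y_m = 4π/m²`, `m = √μ`).
* `Coulomb.integral_background_yukawa_le` — for a background `0 ≤ g ≤ ρ̄`:
  `∫ g(y) K_μ(x - y) dy ≤ ρ̄/μ`.
* `Coulomb.sum_background_yukawa_le` — **for weights `cᵢ ≤ 1`: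
  `∑ᵢ cᵢ ∫ g(y) K_μ(xᵢ - y) dy ≤ N ρ̄/μ`** (`= 4π · n ρ r²/(4π)` at `μ = r⁻²`: the constant in (4.4)).
* `Coulomb.attractive_shortCutoff_ge` — the attractive term with kernel `K_{R⁻²}` is at least the
  one with the cut-off kernel `K_{R⁻²} - K_{r⁻²}` minus `N ρ̄ r²` [LiebSolovej2001, (4.4)].

## References

* [LiebSolovej2001] E. H. Lieb, J. P. Solovej, Commun. Math. Phys. 217 (2001) 127–163, §4, (4.4)
  and Lemma 4.1 (arXiv:cond-mat/0007425, p. 10).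
-/

noncomputable section

open MeasureTheory Set Filter Real
open scoped ENNReal NNReal Topology
open Literature.Analysis.UnboundedOperators

namespace Literature.MathematicalPhysics.QuantumManyBody.Coulomb

open BoseGas

/-! ### The mass of the Yukawa kernel -/

/-- `∫₀^∞ e^{-μs} ds = 1/μ` for `μ > 0`, with integrability. [folklore] -/
theorem integral_Ioi_exp_neg_mul {μ : ℝ} (hμ : 0 < μ) :
    IntegrableOn (fun s : ℝ => Real.exp (-(μ * s))) (Ioi 0) ∧
      ∫ s in Ioi (0 : ℝ), Real.exp (-(μ * s)) = 1 / μ := by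
  have hval : ∫ s in Ioi (0 : ℝ), Real.exp (-(μ * s)) = 1 / μ := by
    have h := integral_exp_mul_Ioi (a := -μ) (by linarith) 0
    simp only [mul_zero, Real.exp_zero, neg_mul] at h
    rw [h, neg_div_neg_eq]
  have hpos : (0 : ℝ) < 1 / μ := by positivity
  have hint : IntegrableOn (fun s : ℝ => Real.exp (-(μ * s))) (Ioi 0) := by
    by_contra h
    rw [IntegrableOn] at h
    rw [integral_undef h] at hval
    exact hpos.ne hval
  exact ⟨hint, hval⟩

/-- **Tonelli for the Yukawa kernel**: `∫_{ℝ³} (∫₀^∞ e^{-μs} G_s(y) ds) dy = 1/μ` (`ℝ≥0∞` form,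
`μ > 0`; `∫ G_s = 1`). [folklore] -/
theorem lintegral_space_lintegral_exp_neg_mul_heatKernel {μ : ℝ} (hμ : 0 < μ) :
    ∫⁻ y : Space, ∫⁻ s in Ioi (0 : ℝ), ENNReal.ofReal (Real.exp (-(μ * s)) * heatKernel s y) =
      ENNReal.ofReal (1 / μ) := by
  have hmeas : Measurable fun q : Space × ℝ => ENNReal.ofReal (Real.exp (-(μ * q.2)) * heatKernel q.2 q.1) :=
    ENNReal.measurable_ofReal.comp ((Real.measurable_exp.comp (measurable_const.mul measurable_snd).neg).mul
      (measurable_heatKernel_uncurry.comp (measurable_snd.prodMk measurable_fst)))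
  rw [lintegral_lintegral_swap hmeas.aemeasurable]
  have step : ∀ s ∈ Ioi (0 : ℝ), ∫⁻ y : Space, ENNReal.ofReal (Real.exp (-(μ * s)) * heatKernel s y) =
      ENNReal.ofReal (Real.exp (-(μ * s))) := by
    intro s hs
    have hs0 : (0 : ℝ) < s := hs
    simp_rw [ENNReal.ofReal_mul (Real.exp_pos _).le]
    rw [lintegral_const_mul' _ _ ENNReal.ofReal_ne_top,
      ← ofReal_integral_eq_lintegral_ofReal (integrable_heatKernel_holds (E := Space) hs0)
        (Eventually.of_forall fun y => (heatKernel_pos hs0 y).le),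
      integral_heatKernel_eq_one_holds (E := Space) hs0, ENNReal.ofReal_one, mul_one]
  rw [setLIntegral_congr_fun measurableSet_Ioi step]
  obtain ⟨hint, hval⟩ := integral_Ioi_exp_neg_mul hμ
  rw [← ofReal_integral_eq_lintegral_ofReal hint (Eventually.of_forall fun s => (Real.exp_pos _).le),
    hval]

/-- **The Yukawa kernel has mass `1/μ`**: for `μ > 0` the kernel
`K_μ(y) = ∫₀^∞ e^{-μs} G_s(y) ds` (`= e^{-√μ|y|}/(4π|y|)` for `y ≠ 0`) is measurable and integrable
on `ℝ³` with `∫ K_μ = 1/μ` — i.e. `∫ e^{-|y|/r}|y|⁻¹ dy = 4πr²`, the constant of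
[LiebSolovej2001, (4.4)]. [cite: LiebSolovej2001, §4 (4.4)] -/
theorem integral_yukawaKernel {μ : ℝ} (hμ : 0 < μ) :
    Measurable (fun y : Space => ∫ s in Ioi (0 : ℝ), Real.exp (-(μ * s)) * heatKernel s y) ∧
      Integrable (fun y : Space => ∫ s in Ioi (0 : ℝ), Real.exp (-(μ * s)) * heatKernel s y) ∧
        ∫ y : Space, ∫ s in Ioi (0 : ℝ), Real.exp (-(μ * s)) * heatKernel s y = 1 / μ := by
  have hm : Measurable (fun y : Space => ∫ s in Ioi (0 : ℝ), Real.exp (-(μ * s)) * heatKernel s y) := by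
    have h : StronglyMeasurable fun q : Space × ℝ => Real.exp (-(μ * q.2)) * heatKernel q.2 q.1 :=
      ((Real.measurable_exp.comp (measurable_const.mul measurable_snd).neg).mul
        (measurable_heatKernel_uncurry.comp (measurable_snd.prodMk measurable_fst))).stronglyMeasurable
    exact (h.integral_prod_right' (ν := volume.restrict (Ioi (0 : ℝ)))).measurable
  have hnn : ∀ y : Space, 0 ≤ ∫ s in Ioi (0 : ℝ), Real.exp (-(μ * s)) * heatKernel s y := fun y =>
    setIntegral_nonneg measurableSet_Ioi fun s hs =>
      mul_nonneg (Real.exp_pos _).le (heatKernel_pos (show (0:ℝ) < s from hs) y).le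
  have hae : ∀ᵐ y : Space ∂volume, y ≠ 0 := by
    have : (volume : Measure Space) {y | ¬y ≠ 0} = 0 := by
      simp only [ne_eq, not_not, setOf_eq_eq_singleton, measure_singleton]
    exact ae_iff.2 this
  have hlin : ∫⁻ y : Space, ENNReal.ofReal (∫ s in Ioi (0 : ℝ), Real.exp (-(μ * s)) * heatKernel s y) =
      ENNReal.ofReal (1 / μ) := by
    rw [← lintegral_space_lintegral_exp_neg_mul_heatKernel hμ]
    refine lintegral_congr_ae ?_
    filter_upwards [hae] with y hy
    exact ofReal_integral_eq_lintegral_ofReal (integral_Ioi_exp_neg_mul_heatKernel hy hμ).1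
      ((ae_restrict_iff' measurableSet_Ioi).2 (Eventually.of_forall fun s hs =>
        mul_nonneg (Real.exp_pos _).le (heatKernel_pos (show (0:ℝ) < s from hs) y).le))
  have hint : Integrable (fun y : Space => ∫ s in Ioi (0 : ℝ), Real.exp (-(μ * s)) * heatKernel s y) := by
    refine ⟨hm.aestronglyMeasurable, (hasFiniteIntegral_iff_ofReal (Eventually.of_forall hnn)).2 ?_⟩
    rw [hlin]
    exact ENNReal.ofReal_lt_top
  refine ⟨hm, hint, ?_⟩
  rw [integral_eq_lintegral_of_nonneg_ae (Eventually.of_forall hnn) hm.aestronglyMeasurable, hlin,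
    ENNReal.toReal_ofReal (by positivity)]

/-! ### The attractive term under the short-distance cutoff -/

/-- **A bounded background in the Yukawa kernel**: for `μ > 0` and a measurable background
`0 ≤ g ≤ ρ̄`, at every `x`, `∫ g(y) K_μ(x - y) dy ≤ ρ̄/μ` (`K_μ` as in `integral_yukawaKernel`).
[cite: LiebSolovej2001, §4 (4.4)] -/
theorem integral_background_yukawa_le {μ : ℝ} (hμ : 0 < μ) {g : Space → ℝ}
    {ρbar : ℝ} (h0 : ∀ y, 0 ≤ g y) (h1 : ∀ y, g y ≤ ρbar) (x : Space) :
    ∫ y, g y * ∫ s in Ioi (0 : ℝ), Real.exp (-(μ * s)) * heatKernel s (x - y) ≤ ρbar / μ := by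
  obtain ⟨-, hKi, hKv⟩ := integral_yukawaKernel hμ
  have hnn : ∀ z : Space, 0 ≤ ∫ s in Ioi (0 : ℝ), Real.exp (-(μ * s)) * heatKernel s z := fun z =>
    setIntegral_nonneg measurableSet_Ioi fun s hs =>
      mul_nonneg (Real.exp_pos _).le (heatKernel_pos (show (0:ℝ) < s from hs) z).le
  have hD : Integrable fun y : Space => ρbar * ∫ s in Ioi (0 : ℝ), Real.exp (-(μ * s)) * heatKernel s (x - y) :=
    (hKi.comp_sub_left x).const_mul ρbar
  have hle : ∫ y, g y * ∫ s in Ioi (0 : ℝ), Real.exp (-(μ * s)) * heatKernel s (x - y) ≤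
      ∫ y, ρbar * ∫ s in Ioi (0 : ℝ), Real.exp (-(μ * s)) * heatKernel s (x - y) :=
    integral_mono_of_nonneg (Eventually.of_forall fun y => mul_nonneg (h0 y) (hnn _)) hD
      (Eventually.of_forall fun y => mul_le_mul_of_nonneg_right (h1 y) (hnn _))
  have hval : ∫ y, ρbar * ∫ s in Ioi (0 : ℝ), Real.exp (-(μ * s)) * heatKernel s (x - y) = ρbar / μ := by
    rw [integral_const_mul, integral_sub_left_eq_self
      (fun z : Space => ∫ s in Ioi (0 : ℝ), Real.exp (-(μ * s)) * heatKernel s z) volume x, hKv]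
    ring
  linarith

/-- **The constant of (4.4)**: for weights `cᵢ ≤ 1` (`cᵢ = χ_ℓ(xᵢ) ∈ [0, 1]`), a background
`0 ≤ g ≤ ρ̄` and `μ > 0`, `∑ᵢ cᵢ ∫ g(y) K_μ(xᵢ - y) dy ≤ N ρ̄/μ`; at `μ = r⁻²` this is `N ρ̄ r²`
(`4π N ρ̄ r²` in the units of the kernel `|x|⁻¹`). [cite: LiebSolovej2001, §4 (4.4)] -/
theorem sum_background_yukawa_le {μ : ℝ} (hμ : 0 < μ) {N : ℕ} {c : Fin N → ℝ}
    (hc1 : ∀ i, c i ≤ 1) (X : Fin N → Space) {g : Space → ℝ}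
    {ρbar : ℝ} (h0 : ∀ y, 0 ≤ g y) (h1 : ∀ y, g y ≤ ρbar) :
    ∑ i, c i * ∫ y, g y * ∫ s in Ioi (0 : ℝ), Real.exp (-(μ * s)) * heatKernel s (X i - y) ≤
      N * (ρbar / μ) := by
  have hnn : ∀ z : Space, 0 ≤ ∫ s in Ioi (0 : ℝ), Real.exp (-(μ * s)) * heatKernel s z := fun z =>
    setIntegral_nonneg measurableSet_Ioi fun s hs =>
      mul_nonneg (Real.exp_pos _).le (heatKernel_pos (show (0:ℝ) < s from hs) z).le
  have hterm : ∀ i, c i * ∫ y, g y * ∫ s in Ioi (0 : ℝ), Real.exp (-(μ * s)) * heatKernel s (X i - y) ≤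
      ρbar / μ := by
    intro i
    have hI : 0 ≤ ∫ y, g y * ∫ s in Ioi (0 : ℝ), Real.exp (-(μ * s)) * heatKernel s (X i - y) :=
      integral_nonneg fun y => mul_nonneg (h0 y) (hnn _)
    calc c i * ∫ y, g y * ∫ s in Ioi (0 : ℝ), Real.exp (-(μ * s)) * heatKernel s (X i - y)
        ≤ 1 * ∫ y, g y * ∫ s in Ioi (0 : ℝ), Real.exp (-(μ * s)) * heatKernel s (X i - y) :=
          mul_le_mul_of_nonneg_right (hc1 i) hI
      _ ≤ ρbar / μ := by
          rw [one_mul]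
          exact integral_background_yukawa_le hμ h0 h1 (X i)
  have h := Finset.sum_le_sum fun i (_ : i ∈ Finset.univ) => hterm i
  rw [Finset.sum_const, Finset.card_univ, Fintype.card_fin, nsmul_eq_mul] at h
  exact h

/-- **The short-distance cutoff in the attractive term** [LiebSolovej2001, (4.4)]: for
`0 < r ≤ R`, weights `cᵢ ≤ 1`, a measurable background `0 ≤ g ≤ ρ̄`, with
`K_μ(z) = ∫₀^∞ e^{-μs} G_s(z) ds` (`= Y_{√μ}(z)/(4π)`),
`-∑ᵢ cᵢ ∫ g(y) K_{R⁻²}(xᵢ - y) dy ≥ -∑ᵢ cᵢ ∫ g(y) (K_{R⁻²} - K_{r⁻²})(xᵢ - y) dy - N ρ̄ r²`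
(the cut-off kernel `K_{R⁻²} - K_{r⁻²} = ∫₀^∞ (e^{-s/R²} - e^{-s/r²}) G_s ds` is the one of
`yukawaCutoff_points_ge` with `a = R⁻¹`, `b = r⁻¹`). [cite: LiebSolovej2001, §4 (4.4)] -/
theorem attractive_shortCutoff_ge {r R : ℝ} (hr : 0 < r) (hrR : r ≤ R) {N : ℕ} {c : Fin N → ℝ}
    (hc1 : ∀ i, c i ≤ 1) (X : Fin N → Space) {g : Space → ℝ}
    (hgm : Measurable g) {ρbar : ℝ} (h0 : ∀ y, 0 ≤ g y) (h1 : ∀ y, g y ≤ ρbar) :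
    -(∑ i, c i * ∫ y, g y * ∫ s in Ioi (0 : ℝ),
        (Real.exp (-((R⁻¹) ^ 2 * s)) - Real.exp (-((r⁻¹) ^ 2 * s))) * heatKernel s (X i - y)) -
        N * ρbar * r ^ 2 ≤
      -(∑ i, c i * ∫ y, g y * ∫ s in Ioi (0 : ℝ), Real.exp (-((R⁻¹) ^ 2 * s)) * heatKernel s (X i - y)) := by
  have hR : 0 < R := hr.trans_le hrR
  have hμr : 0 < (r⁻¹) ^ 2 := by positivity
  have hμR : 0 < (R⁻¹) ^ 2 := by positivity
  -- split the kernel: `K_{R⁻²} = (K_{R⁻²} - K_{r⁻²}) + K_{r⁻²}` inside the `y`-integrals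
  have hKr := integral_yukawaKernel hμr
  have hKR := integral_yukawaKernel hμR
  have hC : ∀ y, |g y| ≤ ρbar := fun y => by rw [abs_of_nonneg (h0 y)]; exact h1 y
  have hgK : ∀ (μ : ℝ) (hμ : 0 < μ) (x : Space), Integrable fun y : Space =>
      g y * ∫ s in Ioi (0 : ℝ), Real.exp (-(μ * s)) * heatKernel s (x - y) := by
    intro μ hμ x
    obtain ⟨hKm, hKi, -⟩ := integral_yukawaKernel hμ
    have hKx : Integrable fun y : Space => ∫ s in Ioi (0 : ℝ), Real.exp (-(μ * s)) * heatKernel s (x - y) :=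
      hKi.comp_sub_left x
    refine hKx.bdd_mul (c := ρbar) hgm.aestronglyMeasurable (Eventually.of_forall fun y => ?_)
    rw [Real.norm_eq_abs]
    exact hC y
  have hsplit : ∀ i, ∫ y, g y * ∫ s in Ioi (0 : ℝ), Real.exp (-((R⁻¹) ^ 2 * s)) * heatKernel s (X i - y) =
      (∫ y, g y * ∫ s in Ioi (0 : ℝ),
        (Real.exp (-((R⁻¹) ^ 2 * s)) - Real.exp (-((r⁻¹) ^ 2 * s))) * heatKernel s (X i - y)) +
      ∫ y, g y * ∫ s in Ioi (0 : ℝ), Real.exp (-((r⁻¹) ^ 2 * s)) * heatKernel s (X i - y) := by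
    intro i
    rw [← integral_add ?_ (hgK _ hμr (X i))]
    · refine integral_congr_ae ?_
      have hae : ∀ᵐ y : Space ∂volume, y ≠ X i := by
        have : (volume : Measure Space) {y | ¬y ≠ X i} = 0 := by
          simp only [ne_eq, not_not, setOf_eq_eq_singleton, measure_singleton]
        exact ae_iff.2 this
      filter_upwards [hae] with y hy
      have hz : X i - y ≠ 0 := sub_ne_zero.2 (Ne.symm hy)
      rw [← mul_add]
      congr 1
      simp_rw [sub_mul]
      rw [integral_sub (integral_Ioi_exp_neg_mul_heatKernel hz hμR).1
        (integral_Ioi_exp_neg_mul_heatKernel hz hμr).1]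
      ring
    · -- integrability of the cut-off term: difference of two integrable terms, a.e.
      refine ((hgK _ hμR (X i)).sub (hgK _ hμr (X i))).congr ?_
      have hae : ∀ᵐ y : Space ∂volume, y ≠ X i := by
        have : (volume : Measure Space) {y | ¬y ≠ X i} = 0 := by
          simp only [ne_eq, not_not, setOf_eq_eq_singleton, measure_singleton]
        exact ae_iff.2 this
      filter_upwards [hae] with y hy
      have hz : X i - y ≠ 0 := sub_ne_zero.2 (Ne.symm hy)
      show g y * (∫ s in Ioi (0 : ℝ), Real.exp (-((R⁻¹) ^ 2 * s)) * heatKernel s (X i - y)) -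
          g y * (∫ s in Ioi (0 : ℝ), Real.exp (-((r⁻¹) ^ 2 * s)) * heatKernel s (X i - y)) =
        g y * ∫ s in Ioi (0 : ℝ),
          (Real.exp (-((R⁻¹) ^ 2 * s)) - Real.exp (-((r⁻¹) ^ 2 * s))) * heatKernel s (X i - y)
      rw [← mul_sub]
      congr 1
      simp_rw [sub_mul]
      rw [integral_sub (integral_Ioi_exp_neg_mul_heatKernel hz hμR).1
        (integral_Ioi_exp_neg_mul_heatKernel hz hμr).1]
  have hsum : ∑ i, c i * ∫ y, g y * ∫ s in Ioi (0 : ℝ), Real.exp (-((R⁻¹) ^ 2 * s)) * heatKernel s (X i - y) =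
      (∑ i, c i * ∫ y, g y * ∫ s in Ioi (0 : ℝ),
        (Real.exp (-((R⁻¹) ^ 2 * s)) - Real.exp (-((r⁻¹) ^ 2 * s))) * heatKernel s (X i - y)) +
      ∑ i, c i * ∫ y, g y * ∫ s in Ioi (0 : ℝ), Real.exp (-((r⁻¹) ^ 2 * s)) * heatKernel s (X i - y) := by
    rw [← Finset.sum_add_distrib]
    refine Finset.sum_congr rfl fun i _ => ?_
    rw [hsplit i]
    ring
  have hbound := sum_background_yukawa_le hμr hc1 X h0 h1
  have hval : (N : ℝ) * (ρbar / (r⁻¹) ^ 2) = N * ρbar * r ^ 2 := by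
    field_simp
  rw [hval] at hbound
  rw [hsum]
  linarith

end Literature.MathematicalPhysics.QuantumManyBody.Coulomb
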